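import Literature.AlgebraicGeometry.Hyperkaehler.GeneralizedKummerType
import Literature.AlgebraicGeometry.HodgeTheory.WeilFourfoldsDiscOnePowers
import Literature.AlgebraicGeometry.HodgeTheory.MotivatedClasses
import HarnessLib

/-!
# The third intermediate Jacobian of a projective `Kumⁿ`-type variety: a discriminant-1 Weil abelian fourfold with `H¹(J³(X)) ≅ H³(X)` induced by an algebraic cycle (O'Grady 2021, Markman 2023) — NAMED FACT

Layer `Literature/AlgebraicGeometry/Hyperkaehler`.  CITE record for the cell `hodge-kum4` (ladder HodgeAV,
rung H3 = the Hodge conjecture for every smooth projective variety of `Kum⁴`-type; cell home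
run/shared/lean/pub/hodge-kum4/, graded input list HOME/lit/LIT-GRADES-r1.md rows L2.4 + L2.6): for every
PROJECTIVE variety `X` of `Kumⁿ`-type, `n ≥ 2` (so `b₃(X) = 8`), the third intermediate Jacobian
`J³(X) = H³(X,ℂ)/(F² + H³(X,ℤ))` is an abelian FOURFOLD OF WEIL TYPE WITH TRIVIAL DISCRIMINANT, and the
canonical identification `H¹(J³(X),ℚ)(-1) ≅ H³(X,ℚ)` is induced by an ALGEBRAIC cycle on `J³(X) × X`.
Together with the tree's record `HodgeTheory.FloccariFu2026_hodgeClasses_algebraic_powers_discOneWeilFourfold`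
(the Hodge conjecture for all powers of every discriminant-1 Weil fourfold, file
`HodgeTheory/WeilFourfoldsDiscOnePowers`, whose binders this file copies symbol for symbol) and
`HodgeTheory.Arapura2006_hodgeClasses_algebraic_of_isDominatedByPowers` (file
`HodgeTheory/DominatedByPowersHodgeConjecture`), this is the abelian variety through which the cell's
lemma L2 ("motivic bookkeeping": `h(X)^Γ ∈ ⟨h¹(J³X)⟩`) routes the Hodge conjecture for `Kum⁴`-type.

## Sources (read: arXiv texts `paper:arxiv-1805.12075`, `paper:arxiv-1805.11574`, `paper:arxiv-2106.06979`,
`paper:arxiv-2308.04865`; page:line = materialised files of the hodge-kum4 literature seat)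

* K. G. O'Grady, *Compact tori associated to hyperkähler manifolds of Kummer type*, Int. Math. Res. Not.
  IMRN 2021, no. 16, 12356–12419 (arXiv:1805.12075) [`OGrady2021KummerTori`; REFEREED], **Theorem 1.5**
  (arXiv numbering, p0003 L66–L74), verbatim: "Let `X` be a hyperkähler variety of Kummer type, of
  dimension `2n`, and let `L` be an ample line bundle on `X`. Then `(J³(X),Θ_L)` is of Weil type, with an
  inclusion `ℚ√(-2(n+1)q_X(L)) ⊂ End(J³(X),Θ_L)_ℚ`, where `q_X(L)` is the value of the
  Beauville-Bogomolov-Fujiki (BBF) quadratic form on `c₁(L)`.  By varying `(X,L)`, one gets a complete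
  (up to isogeny) family of `4` dimensional abelian varieties of Weil type with associated field
  `ℚ[√(-2(n+1)q_X(L))]`, and trivial determinant.  Moreover, tha[t] Kuga-Satake variety `KS(X,L)` is
  isogenous to `J³(X)⁴`."  (p0002 L25: "those of Kummer type are distinguished by the fact that they
  have non zero odd cohomology […] `b₃(X)=8`, and hence there is an associated 4 dimensional
  intermediate Jacobian `J³(X)`".)
* E. Markman, *The monodromy of generalized Kummer varieties and algebraic cycles on their intermediate
  Jacobians*, J. Eur. Math. Soc. 25 (2023) 231–321 (arXiv:1805.11574) [`Markman2023GeneralizedKummers`;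
  REFEREED; arXiv numbering, the JEMS §1 numbers are shifted by +2, cf. the record in
  `WeilFourfoldsDiscOnePowers`]: §1.2 (p0007 L15–L22): "The complex torus `T_ℓ`, `ℓ ∈ Ω_{w^⊥}`, is
  isogenous to the third intermediate Jacobian of every marked `2n`-dimensional irreducible holomorphic
  symplectic manifold `Y` in `𝔐⁰_{w^⊥}` with period `ℓ`, by Lemma [12.9] […] `T_ℓ` comes with a natural
  structure of a polarized abelian fourfold of Weil type `(T_ℓ,ℚ[√-d],Θ_h)` of trivial discriminant
  (Lemma [12.8])"; §12.6 Lemma (p0054 L12): "There exists a global isogeny between the family of third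
  intermediate Jacobians of `p : 𝒴 → 𝔐⁰_{w^⊥}` and the family `Per^*𝒯`"; **Theorem 1.4** (§1.3, p0007
  L62–L64), verbatim: "The morphism `AJ_t` is surjective, for every `t ∈ 𝔐⁰_{ω^⊥}` for which `Y_t` is
  projective" (`AJ_t : M_t → J²(Y_t) := H³(Y_t,ℂ)/[H^{2,1}(Y_t)+H³(Y_t,ℤ)]` the Abel–Jacobi map of the
  algebraic family of codimension-2 cycles `e_t^*[c₂(E_F^∨ ⊗^L E_F) - c₂(E_{F₀}^∨ ⊗^L E_{F₀})]`, p0007 L30–L60).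
* C. Voisin, *Footnotes to papers of O'Grady and Markman*, Math. Z. 300 (2022) 3405–3416
  (arXiv:2106.06979) [`Voisin2022FootnotesOGradyMarkman`; REFEREED], proof of Thm. 4.1 (p0010 L52–L59),
  verbatim: "An equivalent version of Theorem [4.2 = Markman's Thm. 1.4] says that there exists a
  codimension [2] cycle `𝒵 ∈ CH²(J³(X)×X)_ℚ` such that the map `[𝒵]_* : H₁(J³(X),ℚ) → H³(X,ℚ)` is the
  natural identification `H₁(J³(X),ℚ) ≅ H³(X,ℚ)`. […] we can assume that the cohomology class
  `[𝒵] ∈ H⁴(J³(X)×X,ℚ)` belongs to the Künneth component `H¹(J³(X),ℚ) ⊗ H³(X,ℚ)`"; Thm. 1.1 (p0003 L6):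
  "(O'Grady) (1) `J³(X)` is a Weil abelian fourfold."  — AND (added 2026-08-25, for the second
  record below) the rest of that proof, p0010 L60–L95, verbatim: "by another result of Markman
  [markmanBBchar], the class `Q_X ∈ H⁴(X,ℚ)` […] is algebraic on hyper-Kähler manifolds of generalized
  Kummer type. It is thus the class of a cycle `𝒬_X ∈ CH²(X)_ℚ`.  On `J³(X)×X`, we consider the following
  cycle `Γ := 𝒵²·pr_X^*𝒬_X^{[n-2]}` […] **Claim 4.3.** The map `[Γ]_* : H₂(J³(X),ℚ) → H^{4n-2}(X,ℚ)`
  identifies with the O'Grady map `φ : ⋀²H³(X,ℚ) → H⁶(X,ℚ) →^{Q_X} H^{4n-2}(X,ℚ)` […] The claim implies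
  the theorem since we already identified the intermediate Jacobian with a component of the Kuga-Satake
  variety, in such a way that the transpose of the map (eqmorohKS) is the O'Grady map. Thus the map
  (eqmorohKS) or its transpose is induced by an algebraic cycle."  (Thm. 4.1, p0010 L38: "Let `X` be a
  projective hyper-Kähler manifold of generalized Kummer type. Then the Kuga-Satake correspondence of
  `X` is algebraic.")
* K. G. O'Grady, loc. cit., **Theorem 1.1 (1)** (p0002 L74–L80), verbatim: "Let `X` be a HK manifold of
  Kummer type, of dimension `2n`. (1) The map `φ` is surjective, and hence its transpose defines an
  inclusion of integral Hodge structures `H²(X) ⊂ ⋀²H¹(J³(X))`" — where `φ : ⋀²H³(X) → H²(X)^∨` is "the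
  composition of the map `⋀²H³(X) → H^{4n-2}(X)`, `γ∧γ' ↦ γ ⌣ γ' ⌣ q̄_X^{n-2}`, and the map
  `H^{4n-2}(X) → H²(X)^∨` defined by cup product followed by integration" (p0002 L55–L72; the second map
  is Poincaré duality, an isomorphism, so the first map is onto `H^{4n-2}(X)`); standing assumption
  `n ≥ 2` (p0002 L22).
* S. Floccari, M. Varesco, Math. Ann. 391 (2025) (arXiv:2308.04865) [`FloccariVaresco2024`], §1 (p0003
  L10–L12), verbatim: "Markman further constructs an algebraic cycle on `X×J³(X)` realizing the canonical
  isomorphism `H³(X,ℚ) ≅ H¹(J³(X),ℚ)(-1)` of Hodge structures, for any variety `X` of `Kumⁿ`-type."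

## Rendering (tree carriers) and faithfulness

The tree has no intermediate-Jacobian carrier; the fact is recorded as an EXISTENCE statement whose
witness in print is `T = J³(X)` (or Markman's isogenous `T_ℓ`; every clause below is isogeny-invariant
or transported along the isogeny by an algebraic correspondence):
* "projective variety of `Kumⁿ`-type, dimension `2n`, `n ≥ 2`": `2 ≤ n`, `Motives.IsSmoothProjective (2 * n) X`,
  `IsOfGeneralizedKummerType n X` (file `GeneralizedKummerType`), as in every `Kumⁿ` record of this layer.
* "abelian fourfold of Weil type with `ℚ(√-D) ⊂ End_ℚ` and trivial determinant (= discriminant `1`)":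
  EXACTLY the binders of `HodgeTheory.FloccariFu2026_hodgeClasses_algebraic_powers_discOneWeilFourfold`:
  `T : Motives.AbelianVariety ℂ`, `T.dim = 2 * 2`, `φ : T ⟶ T` with `φ ≫ φ = -(d • 𝟙 T)`, `0 < d` (an
  integral multiple `m√-D ∈ End(T)` of the generator, `d = m²D`), a projective embedding `e` of `T.X`, a
  rational class `a ≠ 0` in `H²(ℙ^{e.n}(ℂ); ℂ)`, and `Motives.IsHyperbolicWeilType T φ 2 (d·e^*a + φ^*e^*a)`
  — for fourfolds "hyperbolic ⟺ Witt index `2` ⟺ `det H = (-1)² = 1`" (dictionary of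
  `Motives/HyperbolicWeilType`, van Geemen LNM 1594 Lemma 5.2/5.4), and hyperbolicity of the `K`-symmetrised
  class is that of O'Grady's `Θ_L` (take `e` from a very ample multiple `NΘ_L`; then
  `d·e^*a + φ^*e^*a = 2dN·Θ_L` since `φ^*Θ_L = dΘ_L`, and the Witt index is scale-invariant).  So the
  Weil clause asks for no more than "of Weil type […] trivial determinant" as printed.
* "an algebraic cycle on `X × J³(X)` realizing `H³(X,ℚ) ≅ H¹(J³(X),ℚ)(-1)`": a `ℂ`-linear bijection
  `γ : H¹(T.X(ℂ); ℂ) → H³(X(ℂ); ℂ)` with `HodgeTheory.IsAlgebraicCorrespondence (2 * n) (2 * 2) X T.X γ`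
  (file `HodgeTheory/MotivatedClasses`: `γ = Γ^*` for a class `Γ` in the `ℂ`-span of cycle classes on
  `X × T`; target listed first).  Print gives a RATIONAL cycle; the tree's predicate (ℂ-span of algebraic
  classes) is weaker, so nothing beyond print is asserted.  Degree bookkeeping: `a + 2e = b + 2·dim T`,
  `1 + 2e = 3 + 8`, `e = 5` — Voisin's `𝒵 ∈ CH²` acts `H₁(J) = H⁷(J)^{PD} → H³(X)`; composed with the
  algebraic `L_Θ³ : H¹(J) ≅ H⁷(J)` it is the printed degree-`(-1)`-twist identification of
  Floccari–Varesco's sentence.  Transport to the isogenous `T_ℓ` composes with the graph of an isogeny.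
* NOT asserted: that `T` is literally `J³(X)`; the monodromy/period statements; `KS(X,L) ~ J³(X)⁴`
  (O'Grady Thm. 1.5, last sentence; Kuga–Satake carriers live in `HodgeTheory/KugaSatakeClassBetti`);
  Markman's Hodge-conjecture theorem for `T` (that is `HodgeTheory.Markman2023_weilClasses_algebraic_discOneWeilFourfold`).

## Content

* NAMED FACT `Markman2023_thirdCohomology_kummerType_discOneWeilFourfold` (O'Grady Thm. 1.5 ∧ Markman
  Lemma 12.8/12.9 ∧ Markman Thm. 1.4 in Voisin's reformulation), +1 named fact (D-0026 accounting: a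
  refereed published theorem, cited at the page; no restatement of any tree fact).
* Derived (kernel, modulo this fact and the Floccari–Fu record): `hodgeConjectureFor_powers_thirdJacobian`
  — every projective `Kumⁿ`-type `X`, `n ≥ 2`, carries a disc-1 Weil fourfold `T` with `H¹(T) ≅ H³(X)`
  algebraically AND the Hodge conjecture for every power `T^(k+1)` (this is how L2 of the cell consumes
  Floccari 2026 Thm. 1.3 / Floccari–Fu 2026 Thm. 1.2).
* NAMED FACT (added 2026-08-25) `OGradyVoisin2022_thirdJacobian_kugaSatake_kummerType` — the SAME datum
  `(d, T, φ, e, a, γ)` TOGETHER WITH Voisin's algebraic cycle `Γ = 𝒵²·pr^*𝒬^{n-2} ∈ CH^{2n}(J³(X) × X)`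
  in its printed cohomological effect: a SURJECTIVE `ℂ`-linear map `S : H⁶(T.X(ℂ); ℂ) → H^{4n-2}(X(ℂ); ℂ)`
  (`H₂(J³X) = H⁶(J³X)` by Poincaré duality on the real `8`-torus) with
  `IsAlgebraicCorrespondence (2 * n) (2 * 2) X T.X S` (degree bookkeeping `6 + 2e = (4n-2) + 8`, `e = 2n`
  = the codimension of `Γ`); surjectivity = O'Grady Thm. 1.1 (1) via Voisin's Claim 4.3.  This is the
  Kuga–Satake input of the cell's L2 in the COHOMOLOGICAL SPAN FORM the planner froze (TYPING.md §3:
  "`H²(X(ℂ);ℂ) ≤ dominatedClasses 8 X 4 (J³X) 2`"): `H^{4n-2}(X)` is the image of an algebraic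
  correspondence from `T = J³(X)` itself (power `e = 1`), and `H²(X) = *_L H^{4n-2}(X)` with `*_L`
  algebraic by `Foster2024_lefschetzStandard_kummerType_prime` (file `GeneralizedKummerTypeLefschetzStandard`)
  — that last step is the consumer's, not asserted here.  PROVED: `.markman` (the new record implies the
  old one by forgetting `S`) and the `Kum⁴` spelling `.kum4Type` (`H⁶(T.X) ↠ H¹⁴(X)`).  +1 named fact
  (a refereed published theorem: Math. Z. 2022 Thm. 4.1/Claim 4.3 with IMRN 2021 Thm. 1.1 (1)).
-/

noncomputable section

open CategoryTheory

namespace Literature.AlgebraicGeometry.Hyperkaehler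

open HodgeTheory

/-- **O'Grady 2021 (Thm. 1.5) ∧ Markman 2023 (Lemma 12.8–12.9, Thm. 1.4; Voisin 2022 §4): for every
smooth projective complex variety `X` of `Kumⁿ`-type, `n ≥ 2`, there is an abelian FOURFOLD `T` of Weil
type with discriminant `1` (print: `T = J³(X)`, "of Weil type […] trivial determinant") together with a
bijection `H¹(T(ℂ); ℂ) ≅ H³(X(ℂ); ℂ)` induced by an algebraic correspondence on `X × T` (print: "an
algebraic cycle on `X×J³(X)` realizing the canonical isomorphism `H³(X,ℚ) ≅ H¹(J³(X),ℚ)(-1)`",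
"`𝒵 ∈ CH²(J³(X)×X)_ℚ` such that `[𝒵]_* : H₁(J³(X),ℚ) → H³(X,ℚ)` is the natural identification").**
Binders of the Weil clause = those of `HodgeTheory.FloccariFu2026_hodgeClasses_algebraic_powers_discOneWeilFourfold`
(`0 < d`, `T.dim = 2 * 2`, `φ ≫ φ = -(d • 𝟙 T)`, projective embedding `e`, rational hyperplane class
`a ≠ 0`, `IsHyperbolicWeilType T φ 2 (d·e^*a + φ^*e^*a)`; discriminant `1` ⟺ hyperbolic for fourfolds,
module docstring); correspondence clause = `IsAlgebraicCorrespondence (2 * n) (2 * 2) X T.X γ` with `γ`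
bijective.  A THEOREM in print (REFEREED: IMRN 2021, JEMS 2023, Math. Z. 2022; unproved in the tree).
[cite: OGrady2021KummerTori, Thm. 1.5 (arXiv:1805.12075 §1.2, p. 3)]
[cite: Markman2023GeneralizedKummers, Thm. 1.4 (§1.3) and §12.6 Lemma (global isogeny J³ ~ T_ℓ), Cor. 12.7, arXiv:1805.11574 numbering]
[cite: Voisin2022FootnotesOGradyMarkman, proof of Thm. 4.1 (§4, the cycle 𝒵 ∈ CH²(J³(X) × X))]
[cite: FloccariVaresco2024, §1 (p. 2, "Markman further constructs an algebraic cycle …")] -/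
def Markman2023_thirdCohomology_kummerType_discOneWeilFourfold : Prop :=
  ∀ (n : ℕ), 2 ≤ n → ∀ ⦃X : Motives.SchemeOver ℂ⦄, Motives.IsSmoothProjective (2 * n) X →
    IsOfGeneralizedKummerType n X →
      ∃ (d : ℕ) (T : Motives.AbelianVariety ℂ) (φ : T ⟶ T) (e : Motives.ProjectiveEmbedding T.X)
        (a : complexBetti (Motives.projectiveSpace e.n ℂ) 2)
        (γ : complexBetti T.X 1 →ₗ[ℂ] complexBetti X 3),
        0 < d ∧ T.dim = 2 * 2 ∧ φ ≫ φ = -(d • 𝟙 T) ∧ IsRationalClass a ∧ a ≠ 0 ∧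
          Motives.IsHyperbolicWeilType T φ 2
            ((d : ℂ) • complexBetti.map e.ι 2 a +
              complexBetti.map φ.hom.hom.hom 2 (complexBetti.map e.ι 2 a)) ∧
          Function.Bijective γ ∧ IsAlgebraicCorrespondence (2 * n) (2 * 2) X T.X γ

namespace Markman2023_thirdCohomology_kummerType_discOneWeilFourfold

/-- **Derived (kernel, modulo the two records): every smooth projective `Kumⁿ`-type `X`, `n ≥ 2`, has a
discriminant-1 Weil fourfold `T` with `H¹(T) ≅ H³(X)` by an algebraic correspondence, and the Hodge
conjecture holds for every power `T^(k+1)`** — O'Grady/Markman fed into Floccari 2026 Thm. 1.3 =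
Floccari–Fu 2026 Thm. 1.2 (`hodgeConjectureFor_powSucc_of_floccariFu`).  This is the shape in which the
cell `hodge-kum4` consumes "HC for all powers of `J³(X)`". [cite: Floccari2026, Thm. 1.3 (= Thm. 5.12)]
[cite: OGrady2021KummerTori, Thm. 1.5] -/
theorem hodgeConjectureFor_powers_thirdJacobian
    (h : Markman2023_thirdCohomology_kummerType_discOneWeilFourfold)
    (h5 : FloccariFu2026_hodgeClasses_algebraic_powers_discOneWeilFourfold)
    {n : ℕ} (hn : 2 ≤ n) {X : Motives.SchemeOver ℂ} (hX : Motives.IsSmoothProjective (2 * n) X)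
    (hK : IsOfGeneralizedKummerType n X) :
    ∃ (T : Motives.AbelianVariety ℂ) (γ : complexBetti T.X 1 →ₗ[ℂ] complexBetti X 3),
      T.dim = 2 * 2 ∧ Function.Bijective γ ∧ IsAlgebraicCorrespondence (2 * n) (2 * 2) X T.X γ ∧
        ∀ k : ℕ, HodgeConjectureFor (T.powSucc k).dim (T.powSucc k).X := by
  obtain ⟨d, T, φ, e, a, γ, hd, hT, hφ, ha, ha0, hyp, hγ, hγalg⟩ := h n hn hX hK
  exact ⟨T, γ, hT, hγ, hγalg, fun k ↦ hodgeConjectureFor_powSucc_of_floccariFu h5 hd T φ hT hφ e a ha ha0 hyp k⟩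

/-- The `Kum⁴`-type spelling (dimension `8`) used by the cell `hodge-kum4`. [cite: OGrady2021KummerTori, Thm. 1.5]
[cite: Markman2023GeneralizedKummers, Thm. 1.4 (§1.3)] -/
theorem kum4Type (h : Markman2023_thirdCohomology_kummerType_discOneWeilFourfold)
    {X : Motives.SchemeOver ℂ} (hX : Motives.IsSmoothProjective 8 X) (hK : IsOfGeneralizedKummerType 4 X) :
    ∃ (d : ℕ) (T : Motives.AbelianVariety ℂ) (φ : T ⟶ T) (e : Motives.ProjectiveEmbedding T.X)
      (a : complexBetti (Motives.projectiveSpace e.n ℂ) 2)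
      (γ : complexBetti T.X 1 →ₗ[ℂ] complexBetti X 3),
      0 < d ∧ T.dim = 2 * 2 ∧ φ ≫ φ = -(d • 𝟙 T) ∧ IsRationalClass a ∧ a ≠ 0 ∧
        Motives.IsHyperbolicWeilType T φ 2
          ((d : ℂ) • complexBetti.map e.ι 2 a +
            complexBetti.map φ.hom.hom.hom 2 (complexBetti.map e.ι 2 a)) ∧
        Function.Bijective γ ∧ IsAlgebraicCorrespondence 8 (2 * 2) X T.X γ :=
  h 4 (by norm_num) hX hK

end Markman2023_thirdCohomology_kummerType_discOneWeilFourfold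

/-- **O'Grady 2021 (Thm. 1.1 (1), Thm. 1.5) ∧ Markman 2023 (Thm. 1.4) ∧ Voisin 2022 (Thm. 4.1 with Claim 4.3)
— the third intermediate Jacobian carries BOTH `H³(X)` and (through Voisin's cycle) `H^{4n-2}(X)`:**
for every smooth projective complex `X` of `Kumⁿ`-type, `n ≥ 2`, there are a discriminant-1 Weil abelian
fourfold `T` (print: `J³(X)`; Weil binders as in
`HodgeTheory.FloccariFu2026_hodgeClasses_algebraic_powers_discOneWeilFourfold`), a bijective
`γ : H¹(T(ℂ); ℂ) → H³(X(ℂ); ℂ)` induced by an algebraic correspondence (Markman's cycle `𝒵`), and a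
SURJECTIVE `S : H⁶(T(ℂ); ℂ) → H^{4n-2}(X(ℂ); ℂ)` induced by an algebraic correspondence (Voisin's cycle
`Γ = 𝒵²·pr_X^*𝒬_X^{n-2} ∈ CH^{2n}(J³(X) × X)`: "The map `[Γ]_* : H₂(J³(X),ℚ) → H^{4n-2}(X,ℚ)` identifies with
the O'Grady map", and O'Grady: "The map `φ` is surjective, and hence its transpose defines an inclusion
[…] `H²(X) ⊂ ⋀²H¹(J³(X))`"; `H₂ = H⁶` on the real `8`-torus by Poincaré duality).  Degree bookkeeping of
`IsAlgebraicCorrespondence (2 * n) (2 * 2) X T.X S`: `6 + 2e = (4n - 2) + 2·4`, `e = 2n` = codim `Γ`.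
Nothing beyond print: a rational cycle is in particular a class in the `ℂ`-span of cycle classes; the
identification of `S` with `φ` and the algebraicity of `q̄_X` (Markman) are provenance, not asserted.
A THEOREM in print (REFEREED: IMRN 2021, JEMS 2023, Math. Z. 2022; unproved in the tree).
[cite: OGrady2021KummerTori, Thm. 1.1 (1) (arXiv:1805.12075 p. 2) and Thm. 1.5 (p. 3)]
[cite: Voisin2022FootnotesOGradyMarkman, Thm. 4.1 and Claim 4.3 with the proof's last paragraph (§4, arXiv:2106.06979 p. 10)]
[cite: Markman2023GeneralizedKummers, Thm. 1.4 (§1.3) and §12.6, arXiv:1805.11574 numbering] -/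
def OGradyVoisin2022_thirdJacobian_kugaSatake_kummerType : Prop :=
  ∀ (n : ℕ), 2 ≤ n → ∀ ⦃X : Motives.SchemeOver ℂ⦄, Motives.IsSmoothProjective (2 * n) X →
    IsOfGeneralizedKummerType n X →
      ∃ (d : ℕ) (T : Motives.AbelianVariety ℂ) (φ : T ⟶ T) (e : Motives.ProjectiveEmbedding T.X)
        (a : complexBetti (Motives.projectiveSpace e.n ℂ) 2)
        (γ : complexBetti T.X 1 →ₗ[ℂ] complexBetti X 3)
        (S : complexBetti T.X 6 →ₗ[ℂ] complexBetti X (4 * n - 2)),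
        0 < d ∧ T.dim = 2 * 2 ∧ φ ≫ φ = -(d • 𝟙 T) ∧ IsRationalClass a ∧ a ≠ 0 ∧
          Motives.IsHyperbolicWeilType T φ 2
            ((d : ℂ) • complexBetti.map e.ι 2 a +
              complexBetti.map φ.hom.hom.hom 2 (complexBetti.map e.ι 2 a)) ∧
          Function.Bijective γ ∧ IsAlgebraicCorrespondence (2 * n) (2 * 2) X T.X γ ∧
          Function.Surjective S ∧ IsAlgebraicCorrespondence (2 * n) (2 * 2) X T.X S

namespace OGradyVoisin2022_thirdJacobian_kugaSatake_kummerType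

/-- Forgetting Voisin's `S` gives back the O'Grady–Markman record of this file. [cite: OGrady2021KummerTori, Thm. 1.5]
[cite: Markman2023GeneralizedKummers, Thm. 1.4 (§1.3)] -/
theorem markman (h : OGradyVoisin2022_thirdJacobian_kugaSatake_kummerType) :
    Markman2023_thirdCohomology_kummerType_discOneWeilFourfold := by
  intro n hn X hX hK
  obtain ⟨d, T, φ, e, a, γ, S, hd, hT, hφ, ha, ha0, hyp, hγ, hγalg, -, -⟩ := h n hn hX hK
  exact ⟨d, T, φ, e, a, γ, hd, hT, hφ, ha, ha0, hyp, hγ, hγalg⟩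

/-- The `Kum⁴`-type spelling (dimension `8`; `S : H⁶(T(ℂ)) ↠ H¹⁴(X(ℂ))`) used by the cell `hodge-kum4`:
the datum feeding L2 — `T` with the Hodge conjecture for all powers available from
`Markman2023_thirdCohomology_kummerType_discOneWeilFourfold.hodgeConjectureFor_powers_thirdJacobian`,
`H³(X) = γ(H¹(T))`, `H¹⁴(X) = S(H⁶(T))`. [cite: OGrady2021KummerTori, Thm. 1.1 (1)]
[cite: Voisin2022FootnotesOGradyMarkman, Thm. 4.1, Claim 4.3] -/
theorem kum4Type (h : OGradyVoisin2022_thirdJacobian_kugaSatake_kummerType)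
    {X : Motives.SchemeOver ℂ} (hX : Motives.IsSmoothProjective 8 X) (hK : IsOfGeneralizedKummerType 4 X) :
    ∃ (d : ℕ) (T : Motives.AbelianVariety ℂ) (φ : T ⟶ T) (e : Motives.ProjectiveEmbedding T.X)
      (a : complexBetti (Motives.projectiveSpace e.n ℂ) 2)
      (γ : complexBetti T.X 1 →ₗ[ℂ] complexBetti X 3)
      (S : complexBetti T.X 6 →ₗ[ℂ] complexBetti X 14),
      0 < d ∧ T.dim = 2 * 2 ∧ φ ≫ φ = -(d • 𝟙 T) ∧ IsRationalClass a ∧ a ≠ 0 ∧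
        Motives.IsHyperbolicWeilType T φ 2
          ((d : ℂ) • complexBetti.map e.ι 2 a +
            complexBetti.map φ.hom.hom.hom 2 (complexBetti.map e.ι 2 a)) ∧
        Function.Bijective γ ∧ IsAlgebraicCorrespondence 8 (2 * 2) X T.X γ ∧
        Function.Surjective S ∧ IsAlgebraicCorrespondence 8 (2 * 2) X T.X S :=
  h 4 (by norm_num) hX hK

/-- With the Floccari–Fu record: the `Kum⁴` datum together with the Hodge conjecture for every power
`T^(k+1)` of the fourfold. [cite: Floccari2026, Thm. 1.3 (= Thm. 5.12)] [cite: OGrady2021KummerTori, Thm. 1.1 (1), Thm. 1.5] -/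
theorem kum4Type_powers (h : OGradyVoisin2022_thirdJacobian_kugaSatake_kummerType)
    (h5 : FloccariFu2026_hodgeClasses_algebraic_powers_discOneWeilFourfold)
    {X : Motives.SchemeOver ℂ} (hX : Motives.IsSmoothProjective 8 X) (hK : IsOfGeneralizedKummerType 4 X) :
    ∃ (T : Motives.AbelianVariety ℂ) (γ : complexBetti T.X 1 →ₗ[ℂ] complexBetti X 3)
      (S : complexBetti T.X 6 →ₗ[ℂ] complexBetti X 14),
      T.dim = 2 * 2 ∧ Function.Bijective γ ∧ IsAlgebraicCorrespondence 8 (2 * 2) X T.X γ ∧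
        Function.Surjective S ∧ IsAlgebraicCorrespondence 8 (2 * 2) X T.X S ∧
        ∀ k : ℕ, HodgeConjectureFor (T.powSucc k).dim (T.powSucc k).X := by
  obtain ⟨d, T, φ, e, a, γ, S, hd, hT, hφ, ha, ha0, hyp, hγ, hγalg, hS, hSalg⟩ := h.kum4Type hX hK
  exact ⟨T, γ, S, hT, hγ, hγalg, hS, hSalg,
    fun k ↦ hodgeConjectureFor_powSucc_of_floccariFu h5 hd T φ hT hφ e a ha ha0 hyp k⟩

end OGradyVoisin2022_thirdJacobian_kugaSatake_kummerType

end Literature.AlgebraicGeometry.Hyperkaehler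

end
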